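import Literature.MathematicalPhysics.StatisticalMechanics.BarlowStackingEnergy
import Literature.MathematicalPhysics.StatisticalMechanics.Crystallization
import Mathlib

/-!
# Increment convexity of the alternating block energy, II: calculus of the layer terms

Helper for stub `stub_convexity` of line `Sketch` of crux `PeriodicGivenLayered`
(stmt-AtomisticToContinuum-11779). Midpoint-defect lower bounds from second-derivative lower
bounds (for one function and termwise for a `tsum`), the Lennard-Jones layer term
`V_LJ(√(c + H²)) = (1/12)(c + H²)⁻⁶ - (1/6)(c + H²)⁻³` as a function of the height `H` with its
first two derivatives, the rewriting of `layerInteraction lennardJones a H δ 1` as the lattice sum of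
these terms, and the scaling identity expressing the second derivative through `t = H²/a²`.
[folklore]
-/

noncomputable section

namespace Summit.AtomisticToContinuum.Crystallization.Theorems.LayeredHull

open Literature.MathematicalPhysics.StatisticalMechanics

/-! ## Midpoint defects from second derivatives -/

/-- **Midpoint defect from a second-derivative lower bound**: if `g'' ≥ m` on `[p, r]` then
`(m/4)(h - h')² ≤ g h + g h' - 2 g ((h+h')/2)` for `h, h' ∈ [p, r]` (convexity of
`g - (m/2) x²`). [folklore] -/
theorem cvx_midpoint_lower {g g' g'' : ℝ → ℝ} {p r m : ℝ}
    (hg : ∀ x ∈ Set.Icc p r, HasDerivAt g (g' x) x)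
    (hg' : ∀ x ∈ Set.Icc p r, HasDerivAt g' (g'' x) x)
    (hm : ∀ x ∈ Set.Icc p r, m ≤ g'' x) {h h' : ℝ} (hh : h ∈ Set.Icc p r)
    (hh' : h' ∈ Set.Icc p r) :
    m / 4 * (h - h') ^ 2 ≤ g h + g h' - 2 * g ((h + h') / 2) := by
  have hG1 : ∀ x ∈ Set.Icc p r,
      HasDerivAt (fun x => g x - m / 2 * x ^ 2) (g' x - m * x) x := by
    intro x hx
    have h2 : HasDerivAt (fun x : ℝ => x ^ 2) (2 * x) x := by
      simpa using hasDerivAt_pow 2 x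
    exact ((hg x hx).sub (h2.const_mul (m / 2))).congr_deriv (by ring)
  have hG2 : ∀ x ∈ Set.Icc p r, HasDerivAt (fun x => g' x - m * x) (g'' x - m) x := by
    intro x hx
    exact ((hg' x hx).sub ((hasDerivAt_id x).const_mul m)).congr_deriv (by simp)
  have hconv : ConvexOn ℝ (Set.Icc p r) (fun x => g x - m / 2 * x ^ 2) := by
    apply convexOn_of_hasDerivWithinAt2_nonneg (convex_Icc p r) (f' := fun x => g' x - m * x)
      (f'' := fun x => g'' x - m)
    · exact fun x hx => (hG1 x hx).continuousAt.continuousWithinAt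
    · intro x hx
      exact (hG1 x (interior_subset hx)).hasDerivWithinAt
    · intro x hx
      exact (hG2 x (interior_subset hx)).hasDerivWithinAt
    · intro x hx
      have := hm x (interior_subset hx)
      linarith
  have key := hconv.2 hh hh' (show (0 : ℝ) ≤ 1 / 2 by norm_num)
    (show (0 : ℝ) ≤ 1 / 2 by norm_num) (show (1 / 2 : ℝ) + 1 / 2 = 1 by norm_num)
  simp only [smul_eq_mul] at key
  have e : 1 / 2 * h + 1 / 2 * h' = (h + h') / 2 := by ring
  rw [e] at key
  nlinarith [key]

/-- **Termwise midpoint defect for a series**: if each `f i` has `f i'' ≥ ℓ i` on `[p, r]`, the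
family `ℓ` is summable and `i ↦ f i x` is summable for `x ∈ [p, r]`, then
`(∑' ℓ)/4 · (h - h')² ≤ ∑' f(h) + ∑' f(h') - 2 ∑' f((h+h')/2)`. [folklore] -/
theorem cvx_tsum_defect_lower {ι : Type*} {f f' f'' : ι → ℝ → ℝ} {ℓ : ι → ℝ} {p r : ℝ}
    (hf : ∀ i, ∀ x ∈ Set.Icc p r, HasDerivAt (f i) (f' i x) x)
    (hf' : ∀ i, ∀ x ∈ Set.Icc p r, HasDerivAt (f' i) (f'' i x) x)
    (hℓ : ∀ i, ∀ x ∈ Set.Icc p r, ℓ i ≤ f'' i x) (hℓs : Summable ℓ)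
    (hfs : ∀ x ∈ Set.Icc p r, Summable fun i => f i x) {h h' : ℝ} (hh : h ∈ Set.Icc p r)
    (hh' : h' ∈ Set.Icc p r) :
    (∑' i, ℓ i) / 4 * (h - h') ^ 2 ≤
      (∑' i, f i h) + (∑' i, f i h') - 2 * ∑' i, f i ((h + h') / 2) := by
  have hmid : (h + h') / 2 ∈ Set.Icc p r :=
    ⟨by linarith [hh.1, hh'.1], by linarith [hh.2, hh'.2]⟩
  have hterm : ∀ i, ℓ i / 4 * (h - h') ^ 2 ≤ f i h + f i h' - 2 * f i ((h + h') / 2) :=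
    fun i => cvx_midpoint_lower (hf i) (hf' i) (hℓ i) hh hh'
  have hs1 : Summable fun i => f i h + f i h' := (hfs h hh).add (hfs h' hh')
  have hs2 : Summable fun i => 2 * f i ((h + h') / 2) := (hfs _ hmid).mul_left 2
  have hsum_rhs : Summable fun i => f i h + f i h' - 2 * f i ((h + h') / 2) := hs1.sub hs2
  have hsum_lhs : Summable fun i => ℓ i / 4 * (h - h') ^ 2 := (hℓs.div_const 4).mul_right _
  have key := Summable.tsum_le_tsum hterm hsum_lhs hsum_rhs
  rw [tsum_mul_right, tsum_div_const, Summable.tsum_sub hs1 hs2,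
    Summable.tsum_add (hfs h hh) (hfs h' hh'), tsum_mul_left] at key
  exact key

/-! ## The Lennard-Jones layer term as a function of the height -/

/-- `V_LJ(√q) = (1/12) q⁻⁶ - (1/6) q⁻³` for `q ≥ 0`. [folklore] -/
theorem cvx_lennardJones_sqrt (q : ℝ) (hq : 0 ≤ q) :
    lennardJones (Real.sqrt q) = 1 / 12 * (q⁻¹) ^ 6 - 1 / 6 * (q⁻¹) ^ 3 := by
  have h2 : ((Real.sqrt q)⁻¹) ^ 2 = q⁻¹ := by rw [inv_pow, Real.sq_sqrt hq]
  have h12 : ((Real.sqrt q)⁻¹) ^ 12 = (q⁻¹) ^ 6 := by rw [← h2, ← pow_mul]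
  have h6 : ((Real.sqrt q)⁻¹) ^ 6 = (q⁻¹) ^ 3 := by rw [← h2, ← pow_mul]
  simp only [lennardJones, h12, h6]

/-- The squared norm of `layerVec a H δ 1 i j` is `a² P + H²` with the normalised in-plane
form `P = (i + j/2 + δ/2)² + (3/4)(j + δ/3)²`. [folklore] -/
theorem cvx_norm_layerVec_one (a H : ℝ) (δ i j : ℤ) :
    ‖layerVec a H δ 1 i j‖ = Real.sqrt (a ^ 2 * (((i : ℝ) + j / 2 + δ / 2) ^ 2 +
      3 / 4 * ((j : ℝ) + δ / 3) ^ 2) + H ^ 2) := by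
  rw [norm_layerVec]
  congr 1
  have h3 : Real.sqrt 3 ^ 2 = 3 := Real.sq_sqrt (by norm_num)
  push_cast
  nlinarith [h3]

/-- **The layer interaction as a lattice sum of explicit terms**:
`layerInteraction V_LJ a H δ 1 = ∑'_{(i,j)} [(1/12)(a²P + H²)⁻⁶ - (1/6)(a²P + H²)⁻³]`.
[folklore] -/
theorem cvx_layerInteraction_eq (a H : ℝ) (δ : ℤ) :
    layerInteraction lennardJones a H δ 1 = ∑' ij : ℤ × ℤ,
      (1 / 12 * ((a ^ 2 * (((ij.1 : ℝ) + ij.2 / 2 + δ / 2) ^ 2 +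
        3 / 4 * ((ij.2 : ℝ) + δ / 3) ^ 2) + H ^ 2)⁻¹) ^ 6 -
      1 / 6 * ((a ^ 2 * (((ij.1 : ℝ) + ij.2 / 2 + δ / 2) ^ 2 +
        3 / 4 * ((ij.2 : ℝ) + δ / 3) ^ 2) + H ^ 2)⁻¹) ^ 3) := by
  unfold layerInteraction
  refine tsum_congr fun ij => ?_
  rw [cvx_norm_layerVec_one, cvx_lennardJones_sqrt _ (by positivity)]

/-- Derivative of `x ↦ (c + x²)⁻¹`. [folklore] -/
theorem cvx_hasDerivAt_inv_quad (c x : ℝ) (h : c + x ^ 2 ≠ 0) :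
    HasDerivAt (fun x => (c + x ^ 2)⁻¹) (-(2 * x) * ((c + x ^ 2)⁻¹) ^ 2) x := by
  have h1 : HasDerivAt (fun x => c + x ^ 2) (2 * x) x := by
    simpa using (hasDerivAt_pow 2 x).const_add c
  exact (h1.inv h).congr_deriv (by rw [inv_pow, div_eq_mul_inv])

/-- **First derivative of the layer term** `E(x) = (1/12)(c+x²)⁻⁶ - (1/6)(c+x²)⁻³`:
`E'(x) = x ((c+x²)⁻⁴ - (c+x²)⁻⁷)`. [folklore] -/
theorem cvx_hasDerivAt_E (c x : ℝ) (h : c + x ^ 2 ≠ 0) :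
    HasDerivAt (fun x => 1 / 12 * ((c + x ^ 2)⁻¹) ^ 6 - 1 / 6 * ((c + x ^ 2)⁻¹) ^ 3)
      (x * (((c + x ^ 2)⁻¹) ^ 4 - ((c + x ^ 2)⁻¹) ^ 7)) x := by
  have hw := cvx_hasDerivAt_inv_quad c x h
  refine (((hw.fun_pow 6).const_mul (1 / 12)).sub ((hw.fun_pow 3).const_mul (1 / 6))).congr_deriv
    ?_
  simp only [Nat.cast_ofNat, show (6 - 1 : ℕ) = 5 from rfl, show (3 - 1 : ℕ) = 2 from rfl]
  ring

/-- **Second derivative of the layer term**: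
`E''(x) = (c+x²)⁻⁴ - (c+x²)⁻⁷ - 8x²(c+x²)⁻⁵ + 14x²(c+x²)⁻⁸`. [folklore] -/
theorem cvx_hasDerivAt_E' (c x : ℝ) (h : c + x ^ 2 ≠ 0) :
    HasDerivAt (fun x => x * (((c + x ^ 2)⁻¹) ^ 4 - ((c + x ^ 2)⁻¹) ^ 7))
      (((c + x ^ 2)⁻¹) ^ 4 - ((c + x ^ 2)⁻¹) ^ 7 - 8 * x ^ 2 * ((c + x ^ 2)⁻¹) ^ 5 +
        14 * x ^ 2 * ((c + x ^ 2)⁻¹) ^ 8) x := by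
  have hw := cvx_hasDerivAt_inv_quad c x h
  refine ((hasDerivAt_id x).mul ((hw.fun_pow 4).sub (hw.fun_pow 7))).congr_deriv ?_
  simp only [Nat.cast_ofNat, show (4 - 1 : ℕ) = 3 from rfl, show (7 - 1 : ℕ) = 6 from rfl, id,
    Pi.sub_apply]
  ring

/-- **Scaling identity for the second derivative**: with `c = a² P` and `t = x²/a²`,
`E''(x) = a⁻⁸ [a⁻⁶ (P+t)⁻⁸ (13t - P) - (P+t)⁻⁵ (7t - P)]`. [folklore] -/
theorem cvx_site_scale (a P x : ℝ) (ha : 0 < a) (hq : 0 < P + x ^ 2 / a ^ 2) :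
    ((a ^ 2 * P + x ^ 2)⁻¹) ^ 4 - ((a ^ 2 * P + x ^ 2)⁻¹) ^ 7 -
        8 * x ^ 2 * ((a ^ 2 * P + x ^ 2)⁻¹) ^ 5 + 14 * x ^ 2 * ((a ^ 2 * P + x ^ 2)⁻¹) ^ 8 =
      (a⁻¹) ^ 8 * ((a⁻¹) ^ 6 * ((P + x ^ 2 / a ^ 2)⁻¹) ^ 8 * (13 * (x ^ 2 / a ^ 2) - P) -
        ((P + x ^ 2 / a ^ 2)⁻¹) ^ 5 * (7 * (x ^ 2 / a ^ 2) - P)) := by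
  have ha0 : a ≠ 0 := ha.ne'
  have hq' : a ^ 2 * P + x ^ 2 = a ^ 2 * (P + x ^ 2 / a ^ 2) := by field_simp
  rw [hq']
  have hne : P + x ^ 2 / a ^ 2 ≠ 0 := hq.ne'
  set u := P + x ^ 2 / a ^ 2 with hu
  have hx : x ^ 2 = a ^ 2 * (u - P) := by rw [hu]; field_simp; ring
  rw [show x ^ 2 / a ^ 2 = u - P by rw [hx]; field_simp]
  rw [hx]
  field_simp
  ring

end Summit.AtomisticToContinuum.Crystallization.Theorems.LayeredHull

end
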